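import Summits.ResolutionOfSingularities.ResolutionOfSingularities.Theorems.PurelyInseparableDim4LocalGameSymmetry
import Summits.ResolutionOfSingularities.ResolutionOfSingularities.Theorems.PurelyInseparableDim4BinomialClassCover
import HarnessLib

/-!
# [OURS · res-dim4-pi · F4-C-loc] THE BINOMIAL CLASS THEOREM of the (3,3) LOCAL census: every two-monomial state
  `⟨x^a + c·x^b, 0, ∅⟩` of the census class wins OUR local in-scope game over EVERY field of characteristic 3

Cell `res-dim4-pi` (D-0157 DOOR 2, wave 2), seat `res-dim4-p-6` g5, desk WORD #210 (b).  The (3,3) LOCAL symbolic census of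
record (g3 `census.py gen_roots`: exponent vectors in `{0,…,3}⁴` of total degree `≥ 3` and not a cube monomial, pairs
`a ≠ b`, unit `c ∈ 𝔽₃ˣ`, one representative per `S₄`-class — 3,782 roots) is kernel-certified root by root in ≈ 190
modules (aggregated in `…BinomialCensusRoots{A,B,C}`).  This file turns the table into ONE quantified theorem,
**`binomial_localWin_allFields`**: for EVERY `a ≠ b` in the class (both orderings, every `S₄`-position — not only the
representatives) and every unit `c`, `RWins 3 localB (liftState L ⟨[(a,1),(b,c)], 0, ∅⟩.toState)` over every field `L` of
characteristic 3.  Assembly: the game is `S₄`-invariant and unit-scalar invariant (`…LocalGameSymmetry`: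
`rWins_localB_rename_iff`, `rWins_C_mul_iff`; the swapped ordering is the scalar image, `liftState_swap`:
`x^b + c·x^a = c·(x^a + c·x^b)` in `𝔽₃`), the kernel coverage check `BinomialClass.classOK_true` and its bridges
(`…BinomialClassCover`), and the aggregated root theorems (`allRoots_win`).

HONEST SCOPE: a theorem about OUR local in-scope game (`LoopCLocal.RWins 3 localB`: A blows up permissible coordinate centres
at in-scope states, B answers with equimultiple closed points over the current point) on ONE explicit finite class of
presented states; F4-C-loc(3,3) as an ∃-rule statement for ALL states stays OPEN; nothing here is Hironaka's polyhedra game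
in general.  [OURS · counted 0 · AI kernel work, weaker than expert review.]  NOTHING here is a statement about resolution
of singularities; resolution in dimension `≥ 4` / characteristic `p > 0` is NOT proved by anything in this file.
bears_on: LADDER-RESOLUTION:D157-DOOR2 (res-dim4-pi · (3,3) LOCAL binomial class).  Host item (DR-157-C):
`stmt-ResolutionOfSingularities-16155`, helper.
-/

set_option linter.dupNamespace false -- mandated namespace of this single-conjunct summit

noncomputable section

open MvPolynomial Finset

namespace Summit.ResolutionOfSingularities.ResolutionOfSingularities.Theorems.PIDim4

namespace LoopCLocal

open Literature.AlgebraicGeometry.Resolution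
open Literature.AlgebraicGeometry.Resolution.CentreBlowup
open StepKit BinomialCensus

namespace BinomialClass

/-! ## §4 The theorem -/

section Main

variable (L : Type) [Field L] [CharP L 3] [DecidableEq L]

/-- every certified root is a LOCAL A-win over `L`. [OURS] -/
theorem allRoots_win : ∀ s ∈ allRoots, RWins 3 localB (liftState L s.toState) :=
  List.forall_mem_append.mpr ⟨rootsA_win L, List.forall_mem_append.mpr ⟨rootsB_win L, rootsC_win L⟩⟩

omit [DecidableEq L] in
/-- the swapped ordering is the unit-scalar image: `⟨x^v + c·x^u, 0, ∅⟩` lifted is `c • ⟨x^u + c·x^v, 0, ∅⟩` lifted. [OURS] -/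
theorem liftState_swap (u v : Fin 4 → ℕ) {c : ZMod 3} (hc : c ≠ 0) :
    liftState L ((⟨[(v, 1), (u, c)], 0, ∅⟩ : SData 4 (ZMod 3)).toState) =
      ⟨C (φ3 L c) * (liftState L ((⟨[(u, 1), (v, c)], 0, ∅⟩ : SData 4 (ZMod 3)).toState)).F,
        (liftState L ((⟨[(u, 1), (v, c)], 0, ∅⟩ : SData 4 (ZMod 3)).toState)).r,
        (liftState L ((⟨[(u, 1), (v, c)], 0, ∅⟩ : SData 4 (ZMod 3)).toState)).exc⟩ := by
  have hcc : c * c = 1 := by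
    fin_cases c
    · exact absurd rfl hc
    · rfl
    · rfl
  show (⟨MvPolynomial.map (φ3 L) (evalT [(v, 1), (u, c)]), expo (0 : Fin 4 → ℕ), ∅⟩ : State L) =
    ⟨C (φ3 L c) * MvPolynomial.map (φ3 L) (evalT [(u, 1), (v, c)]), expo (0 : Fin 4 → ℕ), ∅⟩
  congr 1
  rw [← map_C (φ3 L) c, ← map_mul]
  congr 1
  simp only [evalT_cons, evalT_nil, add_zero, mul_add, C_mul_monomial, mul_one, hcc]
  rw [add_comm]

/-- **THE BINOMIAL CLASS THEOREM of the (3,3) LOCAL census.**  For every field `L` of characteristic 3, all exponent vectors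
`a ≠ b` in `{0,…,3}⁴`, each of total degree `≥ 3` and each not a cube monomial, and every unit `c` of `𝔽₃`, the presented
state `⟨x^a + c·x^b, 0, ∅⟩` is an A-win of OUR local in-scope game `RWins 3 localB` over `L`.  (The census class of record,
g3 `census.py gen_roots`, in every `S₄`-position and both orderings; located finite class — F4-C-loc(3,3) for all states
stays OPEN; nothing about resolution of singularities.) [OURS · ‖ K] -/
theorem binomial_localWin_allFields (a b : Fin 4 → ℕ) (c : ZMod 3) (ha : ∀ i, a i ≤ 3) (hb : ∀ i, b i ≤ 3)
    (ha3 : 3 ≤ ∑ i, a i) (hb3 : 3 ≤ ∑ i, b i) (hac : ¬ ∀ i, 3 ∣ a i) (hbc : ¬ ∀ i, 3 ∣ b i) (hab : a ≠ b)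
    (hc : c ≠ 0) : RWins 3 localB (liftState L ((⟨[(a, 1), (b, c)], 0, ∅⟩ : SData 4 (ZMod 3)).toState)) := by
  have hla := toL_mem_expsOK ha ha3 hac
  have hlb := toL_mem_expsOK hb hb3 hbc
  have hne : toL a ≠ toL b := fun h => hab (toL_injective h)
  have hcv : c.val = 1 ∨ c.val = 2 := by
    fin_cases c
    · exact absurd rfl hc
    · exact Or.inl rfl
    · exact Or.inr rfl
  have hc4 : c.val < 4 := by omega
  -- the covered key, in one of the two orderings
  have key_root : ∀ {x y : Fin 4 → ℕ}, toL x ∈ expsOK → toL y ∈ expsOK → cover.testBit (key (toL x) (toL y) c.val) = true →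
      ∃ (u v : Fin 4 → ℕ) (e : Equiv.Perm (Fin 4)),
        (⟨[(u, 1), (v, c)], 0, ∅⟩ : SData 4 (ZMod 3)) ∈ allRoots ∧ x = u ∘ ⇑e ∧ y = v ∘ ⇑e := by
    intro x y hx hy hcov
    obtain ⟨t, ht, hcov'⟩ := exists_of_testBit_cover hcov
    obtain ⟨s, hs, hst⟩ := List.mem_filterMap.mp ht
    obtain ⟨u, v, c', rfl, rfl, hu, hv⟩ := eq_of_shape hst
    obtain ⟨σ, hσ, hk⟩ := exists_perm_of_testBit_coverOf hcov'
    obtain ⟨e, he⟩ := exists_perm_of_mem_permIdx hσ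
    have hk' : key (toL (u ∘ ⇑e)) (toL (v ∘ ⇑e)) c'.val = key (toL x) (toL y) c.val := by
      rw [← he u, ← he v]; exact hk
    have hinj := key_inj hk' (by have := c'.val_lt; omega) hc4
      (List.forall_mem_append.mpr ⟨forall_mem_toL.mpr fun i => hu _, forall_mem_toL.mpr fun i => hv _⟩)
      (List.forall_mem_append.mpr ⟨(le_three_of_mem_expsOK hx).1, (le_three_of_mem_expsOK hy).1⟩)
      (length_toL _) (length_toL _) (length_toL _) (length_toL _)
    obtain ⟨hcc, hxu, hyv⟩ := hinj
    have hc' : c' = c := ZMod.val_injective 3 hcc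
    subst hc'
    exact ⟨u, v, e, hs, (toL_injective hxu).symm, (toL_injective hyv).symm⟩
  rcases covered_of_classBody hla hlb hne (length_toL _) (length_toL _) hcv with hcov | hcov
  · -- direct ordering: `⟨x^a + c x^b⟩` is the rename of a certified root
    obtain ⟨u, v, e, hmem, rfl, rfl⟩ := key_root hla hlb hcov
    have hw := allRoots_win L _ hmem
    have hren := liftState_rename_terms L e.symm [(u, (1 : ZMod 3)), (v, c)]
    simp only [List.map_cons, List.map_nil, Equiv.symm_symm] at hren
    rw [← hren]
    exact rWins_localB_rename e.symm 3 hw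
  · -- swapped ordering: `⟨x^a + c x^b⟩ = ⟨x^{v e} + c x^{u e}⟩` is `c •` the rename of the root `x^u + c x^v`
    obtain ⟨u, v, e, hmem, rfl, rfl⟩ := key_root hlb hla hcov
    have hw := allRoots_win L _ hmem
    have hren := liftState_rename_terms L e.symm [(u, (1 : ZMod 3)), (v, c)]
    simp only [List.map_cons, List.map_nil, Equiv.symm_symm] at hren
    have hw' : RWins 3 localB (liftState L ((⟨[(u ∘ ⇑e, 1), (v ∘ ⇑e, c)], 0, ∅⟩ : SData 4 (ZMod 3)).toState)) := by
      rw [← hren]; exact rWins_localB_rename e.symm 3 hw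
    rw [liftState_swap L (u ∘ ⇑e) (v ∘ ⇑e) hc]
    have hφ : (φ3 L) c ≠ 0 := (map_ne_zero (φ3 L)).mpr hc
    exact (rWins_C_mul_iff hφ _ _ _).mpr hw'

end Main

end BinomialClass

end LoopCLocal

end Summit.ResolutionOfSingularities.ResolutionOfSingularities.Theorems.PIDim4

end
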